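import Summits.BirchSwinnertonDyer.BirchSwinnertonDyer.Theorems.Rank2ObservatoryRank3RootNumber3Census
import Summits.BirchSwinnertonDyer.BirchSwinnertonDyer.Theorems.Rank2ObservatoryRank3Census
import Summits.BirchSwinnertonDyer.BirchSwinnertonDyer.Theorems.Rank2ObservatoryRank3FullTwoTorsionIsoDoors
import Literature.NumberTheory.EllipticCurves.OddModularDegree
import Literature.NumberTheory.EllipticCurves.BSDRootNumberOddParityProofs
import Literature.NumberTheory.EllipticCurves.BSDSelmer
import HarnessLib

/-!
# BirchSwinnertonDyer — rank ≥ 2 observatory: rank-3 census — THE MODULAR DEGREE OF EVERY RANK-3 CENSUS CURVE IS EVEN,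
# granting Calegari–Emerton: Watkins' conjecture `2^r ∣ m_E` (`r = 3` predicts `8 ∣ m_E`), FIRST BIT, on all 9 487 rows — glue by name

HONEST FRAMING: per-curve certified theorems and census instruments; no claim on BSD in rank ≥ 2.
Nothing here proves BSD, or finiteness of `Ш`, for any curve; nothing here bears on `ord_{s=1} L(E,s)`; no VALUE of any
modular degree is certified, and nothing is claimed in the kernel about `4 ∣ m_E` or `8 ∣ m_E`.  Nothing new
mathematically: pure glue BY NAME (no definitions, no data, no `decide` on tables, no numerics).

WHAT.  Watkins [Watkins2002, Conjecture 4.1 (p. 498)]: if `E/ℚ` has Mordell–Weil rank `r` then `2^r` divides the modular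
degree `m_E = deg(X₀(N) → E)`; later refined to `#Sel₂(E) ∣ m_E` [Dummigan2008, Conj. 1.1 and the paragraph after it
(p. 346)].  For the 9 487 curves of the rank-3 census (`rank3Table`; `rank_ℤ = 3` in the kernel for 9 375 of them, cell index
rows 1–47) this predicts `8 ∣ m_E`.  Calegari–Emerton [CalegariEmerton2008, Theorem 1] — a THEOREM in print, kept in the
tree as the named fact `calegariEmerton_oddModularDegree` and here as the hypothesis `hCE` — says: `m_E` odd ⇒
(i) `4 ∤ N`, (ii) `r_an(E)` is EVEN, (iii) local conditions.  Consequence (ii) with the UNCONDITIONAL half of the parity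
fact (`w(E) = −1 ⇒ r_an(E)` odd: tree theorem `WeierstrassCurve.odd_analyticRank_of_rootNumber_eq_neg_one`, no modularity
input) gives the folklore corollary **`w(E) = −1 ⇒ m_E` even** (§1).  The kernel ROOT-NUMBER CENSUS
(`Rank3Row.rootNumber_eq_neg_one_of_mem`, file `Rank2ObservatoryRank3RootNumber3Census`: `w(E) = −1` for EVERY rank-3
census row, from 9 487 kernel certificates of the local data + the named local-root-number facts `hKD`
[KellockDokchitser2023, Thm. 2.3 and §5] and `hR` [Rizzo2003, Table III]) then yields §2: for every row `r ∈ rank3Table` and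
every modular parametrisation datum `D` of `r.curve` at level `N = conductorNorm ℤ r.curve` of minimal degree,
`Even D.modularDegree` — the first bit of Watkins' prediction, granting `hCE`, `hKD`, `hR`.  For the 986 rows with a
rational 2-torsion point §3 gives a SECOND route in which the 2-parity theorem `hpar : p_parity E 2`
(`(−1)^{corank Sel_{2^∞}(E/ℚ)} = w(E)`) [Monsky1996, Thm. 1.5] [DokchitserDokchitserAnnals2010, Thm. 1.4] replaces
`hKD`/`hR`: there `corank_{ℤ₂} Sel_{2^∞}(E/ℚ) = 3` is a KERNEL theorem (the doors at 2, cell index rows 44/45: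
`Rank3Row.door_two_of_aKey_mem` for the 966 one-2-torsion rows, `Rank3Row.door_two_of_mem_fullTwoTorsionRows` for the
20 full-2-torsion rows), so `w(E) = (−1)^3 = −1` and again `m_E` is even granting `hCE`, `hpar`.

WHAT IS KERNEL / WHAT IS NAMED.  Kernel (landed files, invoked by name): the 9 487 root-number certificates; the 986
descents via 2-isogeny.  Named published theorems kept as hypotheses, exactly as elsewhere in the cell: `hCE`
(Calegari–Emerton), `hKD`/`hR` (local root numbers at additive primes), `hpar` (2-parity).  The modular parametrisation
enters only through the tree's `ModularForms.ModularParametrizationData W N` / `.modularDegree` (file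
`Literature/…/ModularForms/ModularCurve.lean`); its EXISTENCE for these curves (modularity) is not used and not claimed.

CENSUS INSTRUMENT (OUT OF KERNEL — engine data, not a theorem of this file).  Cremona's `alldegphi` tables (ecdata) list
`deg φ` for all 9 487 rows (labels and a-invariants matched 9 487 / 9 487): EVERY value is divisible by `2³` — Watkins'
Conjecture 4.1 holds on the whole rank-3 table; `v₂(deg φ)` has minimum 3 (attained by 76 rows, all without rational
2-torsion — for these the refined form `#Sel₂ ∣ deg φ` would force `Ш(E/ℚ)[2] = 0`) and maximum 20; the 966
one-2-torsion rows have `v₂(deg φ) ≥ 7`, the 20 full-2-torsion rows `v₂(deg φ) ≥ 11`; `deg φ(5077a1) = 1984 = 2⁶·31`.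
Recorded in the cell (`code/b2b-bsdr2-cert-2/sat2-r3/g59/scope59d_degphi.py`, `scope59e_sel2.py`); NOT certified here —
the kernel holds exactly the first bit, conditionally on the named facts.

DO-NOT respected: no claim `L‴(E,1) ≠ 0`, no analytic-rank VALUE, no `n = 1`, no value of `Reg/Ω/#Ш/c_p`, no restatement
of the door / root-number theorems (they are invoked by name).
-/

set_option linter.dupNamespace false
set_option autoImplicit false

open WeierstrassCurve Literature Literature.NumberTheory.EllipticCurves
  Literature.NumberTheory.EllipticCurves.ModularForms

namespace Summit.BirchSwinnertonDyer.BirchSwinnertonDyer.Rank2Observatory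

open IsoLocal

/-! ### §1 General glue: odd analytic rank — in particular `w(E) = −1` — forbids odd modular degree, granting Calegari–Emerton -/

/-- **Granting Calegari–Emerton (`hCE`): an elliptic curve over `ℚ` with ODD analytic rank has EVEN modular degree** —
consequence (ii) of [CalegariEmerton2008, Theorem 1] read contrapositively (`m_E` odd ⇒ `r_an(E)` even).  `D` is any modular
parametrisation datum at level `N(E)` of minimal degree (`hmin`), so `D.modularDegree = m_E`.
[cite: CalegariEmerton2008, Theorem 1 (arXiv:math/0503359, p. 2)] -/
theorem ModularDegreeParity.even_of_odd_analyticRank (hCE : calegariEmerton_oddModularDegree)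
    (W : WeierstrassCurve ℚ) [W.IsElliptic] [NeZero (W.conductorNorm ℤ)]
    (D : ModularParametrizationData W (W.conductorNorm ℤ))
    (hmin : ∀ D' : ModularParametrizationData W (W.conductorNorm ℤ), D.modularDegree ≤ D'.modularDegree)
    (hodd : Odd W.analyticRank) : Even D.modularDegree := by
  rcases Nat.even_or_odd D.modularDegree with he | ho
  · exact he
  · obtain ⟨-, heven, -⟩ := hCE W D hmin ho
    exact absurd heven (Nat.not_even_iff_odd.mpr hodd)

/-- **Granting Calegari–Emerton: `w(E) = −1 ⇒ m_E` is even.**  The sign `−1` makes `r_an(E)` odd UNCONDITIONALLY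
(`WeierstrassCurve.odd_analyticRank_of_rootNumber_eq_neg_one`, [SilvermanAEC2009, C.16 Thm. 16.3 and remark]), while
Calegari–Emerton (ii) forces `r_an(E)` even whenever `m_E` is odd.
[cite: CalegariEmerton2008, Theorem 1 (arXiv:math/0503359, p. 2)] [cite: SilvermanAEC2009, C.16 Thm. 16.3 and remark, p. 451] -/
theorem ModularDegreeParity.even_of_rootNumber_eq_neg_one (hCE : calegariEmerton_oddModularDegree)
    (W : WeierstrassCurve ℚ) [W.IsElliptic] [NeZero (W.conductorNorm ℤ)]
    (D : ModularParametrizationData W (W.conductorNorm ℤ))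
    (hmin : ∀ D' : ModularParametrizationData W (W.conductorNorm ℤ), D.modularDegree ≤ D'.modularDegree)
    (hw : W.rootNumber = -1) : Even D.modularDegree :=
  ModularDegreeParity.even_of_odd_analyticRank hCE W D hmin (W.odd_analyticRank_of_rootNumber_eq_neg_one hw)

/-- **Granting Calegari–Emerton: an ODD modular degree forces the sign `w(E) = +1`** (contrapositive reading:
`m_E` odd ⇒ `r_an` even [CalegariEmerton2008, Theorem 1 (ii)] ⇒ `w(E) = 1`, the unconditional
`WeierstrassCurve.rootNumber_eq_one_of_even_analyticRank`).
[cite: CalegariEmerton2008, Theorem 1 (arXiv:math/0503359, p. 2)] [cite: SilvermanAEC2009, C.16 Thm. 16.3 and remark, p. 451] -/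
theorem ModularDegreeParity.rootNumber_eq_one_of_odd (hCE : calegariEmerton_oddModularDegree)
    (W : WeierstrassCurve ℚ) [W.IsElliptic] [NeZero (W.conductorNorm ℤ)]
    (D : ModularParametrizationData W (W.conductorNorm ℤ))
    (hmin : ∀ D' : ModularParametrizationData W (W.conductorNorm ℤ), D.modularDegree ≤ D'.modularDegree)
    (hodd : Odd D.modularDegree) : W.rootNumber = 1 := by
  obtain ⟨-, heven, -⟩ := hCE W D hmin hodd
  exact W.rootNumber_eq_one_of_even_analyticRank heven

/-- **Granting Calegari–Emerton and the `p`-parity theorem at one prime `p` (`hpar : (−1)^{corank Sel_{p^∞}(E/ℚ)} = w(E)`):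
an ODD `ℤ_p`-corank of `Sel_{p^∞}(E/ℚ)` forces an EVEN modular degree** — `w(E) = (−1)^{odd} = −1`, then the previous
theorem.  (This is the plug for curves whose Selmer corank is known in the kernel, §3.)
[cite: CalegariEmerton2008, Theorem 1 (arXiv:math/0503359, p. 2)] [cite: DokchitserDokchitserAnnals2010, Thm. 1.4]
[cite: Monsky1996, Thm. 1.5] -/
theorem ModularDegreeParity.even_of_p_parity_of_odd_selmerCorank (hCE : calegariEmerton_oddModularDegree)
    (W : WeierstrassCurve ℚ) [W.IsElliptic] [NeZero (W.conductorNorm ℤ)] {p : ℕ} [Fact p.Prime]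
    (hpar : p_parity W p) (hcork : Odd (W.selmerCorank p))
    (D : ModularParametrizationData W (W.conductorNorm ℤ))
    (hmin : ∀ D' : ModularParametrizationData W (W.conductorNorm ℤ), D.modularDegree ≤ D'.modularDegree) :
    Even D.modularDegree := by
  have h : (-1 : ℤ) ^ W.selmerCorank p = W.rootNumber := hpar
  rw [hcork.neg_one_pow] at h
  exact ModularDegreeParity.even_of_rootNumber_eq_neg_one hCE W D hmin h.symm

/-- The same at an arbitrary level term `N` provably equal to the conductor (so that a census-certified conductor VALUE,
e.g. `conductorNorm ℤ r.curve = r.conductor` from the cell's conductor rows, can be substituted for the level).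
[cite: CalegariEmerton2008, Theorem 1 (arXiv:math/0503359, p. 2)] -/
theorem ModularDegreeParity.even_at_level_of_rootNumber_eq_neg_one (hCE : calegariEmerton_oddModularDegree)
    (W : WeierstrassCurve ℚ) [W.IsElliptic] {N : ℕ} [NeZero N] (hN : W.conductorNorm ℤ = N)
    (D : ModularParametrizationData W N)
    (hmin : ∀ D' : ModularParametrizationData W N, D.modularDegree ≤ D'.modularDegree)
    (hw : W.rootNumber = -1) : Even D.modularDegree := by
  subst hN
  exact ModularDegreeParity.even_of_rootNumber_eq_neg_one hCE W D hmin hw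

/-! ### §2 The rank-3 census: EVERY row has even modular degree, granting `hCE` and the local-root-number facts `hKD`, `hR` -/

/-- The level `N(E) = conductorNorm ℤ E` of a census row is nonzero (the conductor of an elliptic curve is a nonzero ideal
of `ℤ`: tree theorem `WeierstrassCurve.conductorNorm_pos_holds`); stated as a THEOREM producing the `NeZero` instance
argument of `ModularParametrizationData`, never as an `instance`. [cite: SilvermanAEC2009, VIII.11 and App. C §16] -/
theorem Rank3Row.neZero_conductorNorm_of_mem {r : Rank3Row} (hr : r ∈ rank3Table) : NeZero (r.curve.conductorNorm ℤ) := by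
  haveI := isElliptic_of_mem hr
  exact ⟨(r.curve.conductorNorm_pos_holds).ne'⟩

/-- **Per row — all 9 487 rank-3 census curves, granting Calegari–Emerton (`hCE`) and the local-root-number facts
(`hKD`, `hR`): the modular degree is EVEN** (`w(E) = −1` in the kernel by `Rank3Row.rootNumber_eq_neg_one_of_mem`, then §1).
Watkins' conjecture predicts `8 ∣ m_E` here; the kernel holds the first bit.
[cite: CalegariEmerton2008, Theorem 1 (arXiv:math/0503359, p. 2)] [cite: Watkins2002, Conjecture 4.1 (p. 498)]
[cite: KellockDokchitser2023, Thm. 2.3 and §5] [cite: Rizzo2003, Table III] -/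
theorem Rank3Row.even_modularDegree_of_mem (hCE : calegariEmerton_oddModularDegree) {r : Rank3Row} (hr : r ∈ rank3Table)
    (hKD : r.curve.rootNumber_eq_neg_finprod_tableLocalRootNumberAt')
    (hR : r.curve.rootNumber_eq_neg_finprod_fullTableLocalRootNumberAt)
    [NeZero (r.curve.conductorNorm ℤ)] (D : ModularParametrizationData r.curve (r.curve.conductorNorm ℤ))
    (hmin : ∀ D' : ModularParametrizationData r.curve (r.curve.conductorNorm ℤ), D.modularDegree ≤ D'.modularDegree) :
    Even D.modularDegree := by
  haveI := isElliptic_of_mem hr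
  exact ModularDegreeParity.even_of_rootNumber_eq_neg_one hCE r.curve D hmin
    (Rank3Row.rootNumber_eq_neg_one_of_mem hr hKD hR)

/-- Per row, `2 ∣ m_E` spelled as a divisibility (Watkins' shape `2^r ∣ m_E`, first bit), granting `hCE`, `hKD`, `hR`.
[cite: Watkins2002, Conjecture 4.1 (p. 498)] [cite: CalegariEmerton2008, Theorem 1 (arXiv:math/0503359, p. 2)] -/
theorem Rank3Row.two_dvd_modularDegree_of_mem (hCE : calegariEmerton_oddModularDegree) {r : Rank3Row} (hr : r ∈ rank3Table)
    (hKD : r.curve.rootNumber_eq_neg_finprod_tableLocalRootNumberAt')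
    (hR : r.curve.rootNumber_eq_neg_finprod_fullTableLocalRootNumberAt)
    [NeZero (r.curve.conductorNorm ℤ)] (D : ModularParametrizationData r.curve (r.curve.conductorNorm ℤ))
    (hmin : ∀ D' : ModularParametrizationData r.curve (r.curve.conductorNorm ℤ), D.modularDegree ≤ D'.modularDegree) :
    2 ^ 1 ∣ D.modularDegree := by
  rw [pow_one]
  exact (Rank3Row.even_modularDegree_of_mem hCE hr hKD hR D hmin).two_dvd

/-- Per row at an arbitrary level term `N` provably equal to the conductor, granting `hCE`, `hKD`, `hR`.
[cite: CalegariEmerton2008, Theorem 1 (arXiv:math/0503359, p. 2)] -/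
theorem Rank3Row.even_modularDegree_at_level_of_mem (hCE : calegariEmerton_oddModularDegree) {r : Rank3Row}
    (hr : r ∈ rank3Table) (hKD : r.curve.rootNumber_eq_neg_finprod_tableLocalRootNumberAt')
    (hR : r.curve.rootNumber_eq_neg_finprod_fullTableLocalRootNumberAt) {N : ℕ} [NeZero N]
    (hN : r.curve.conductorNorm ℤ = N) (D : ModularParametrizationData r.curve N)
    (hmin : ∀ D' : ModularParametrizationData r.curve N, D.modularDegree ≤ D'.modularDegree) : Even D.modularDegree := by
  haveI := isElliptic_of_mem hr
  exact ModularDegreeParity.even_at_level_of_rootNumber_eq_neg_one hCE r.curve hN D hmin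
    (Rank3Row.rootNumber_eq_neg_one_of_mem hr hKD hR)

/-- **No rank-3 census curve has odd modular degree, granting `hCE`, `hKD`, `hR`** (the table-quantified form, with the
table's certified length). [cite: CalegariEmerton2008, Theorem 1 (arXiv:math/0503359, p. 2)] [cite: Watkins2002, Conjecture 4.1 (p. 498)] -/
theorem rank3Table_even_modularDegree (hCE : calegariEmerton_oddModularDegree) :
    rank3Table.length = 9487 ∧
    ∀ r ∈ rank3Table, r.curve.rootNumber_eq_neg_finprod_tableLocalRootNumberAt' →
      r.curve.rootNumber_eq_neg_finprod_fullTableLocalRootNumberAt →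
      ∀ [NeZero (r.curve.conductorNorm ℤ)] (D : ModularParametrizationData r.curve (r.curve.conductorNorm ℤ)),
        (∀ D' : ModularParametrizationData r.curve (r.curve.conductorNorm ℤ), D.modularDegree ≤ D'.modularDegree) →
        ¬ Odd D.modularDegree :=
  ⟨rank3Table_length, fun _ hr hKD hR _ D hmin =>
    Nat.not_odd_iff_even.mpr (Rank3Row.even_modularDegree_of_mem hCE hr hKD hR D hmin)⟩

/-! ### §3 The 986 rows with a rational 2-torsion point: the 2-parity route (`hpar` replaces `hKD`, `hR`) -/

/-- **The 966 one-2-torsion-point rows, granting Calegari–Emerton and 2-parity (`hpar`): even modular degree** — for a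
census row whose model occurs in the KERNEL-ISO table, `corank_{ℤ₂} Sel_{2^∞}(E/ℚ) = 3` is a kernel theorem
(`Rank3Row.door_two_of_aKey_mem`, invoked by name), so `w(E) = (−1)^3 = −1` by `hpar` and §1 applies.
[cite: CalegariEmerton2008, Theorem 1 (arXiv:math/0503359, p. 2)] [cite: Monsky1996, Thm. 1.5]
[cite: DokchitserDokchitserAnnals2010, Thm. 1.4] [cite: SilvermanAEC2009, Prop. X.4.7 and Thm. X.4.2(a)] -/
theorem Rank3Row.even_modularDegree_of_aKey_mem_of_p_parity (hCE : calegariEmerton_oddModularDegree) {r : Rank3Row}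
    (h : aKey₃ r ∈ rank3IsoRows.map IsoRow.aKey) (hpar : p_parity r.curve 2)
    [NeZero (r.curve.conductorNorm ℤ)] (D : ModularParametrizationData r.curve (r.curve.conductorNorm ℤ))
    (hmin : ∀ D' : ModularParametrizationData r.curve (r.curve.conductorNorm ℤ), D.modularDegree ≤ D'.modularDegree) :
    Even D.modularDegree := by
  obtain ⟨hE, -, -, -, -, hsel⟩ := Rank3Row.door_two_of_aKey_mem h
  haveI := hE
  exact ModularDegreeParity.even_of_p_parity_of_odd_selmerCorank hCE r.curve hpar (by rw [hsel]; decide) D hmin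

/-- **The 20 full-2-torsion rows, granting Calegari–Emerton and 2-parity (`hpar`): even modular degree** —
`corank_{ℤ₂} Sel_{2^∞}(E/ℚ) = 3` is a kernel theorem for each (`Rank3Row.door_two_of_mem_fullTwoTorsionRows`, by name).
[cite: CalegariEmerton2008, Theorem 1 (arXiv:math/0503359, p. 2)] [cite: Monsky1996, Thm. 1.5]
[cite: DokchitserDokchitserAnnals2010, Thm. 1.4] [cite: SilvermanAEC2009, Prop. X.4.7 and Thm. X.4.2(a)] -/
theorem Rank3Row.even_modularDegree_of_mem_fullTwoTorsionRows_of_p_parity (hCE : calegariEmerton_oddModularDegree)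
    {r : Rank3Row} (hr : r ∈ rank3FullTwoTorsionRows) (hpar : p_parity r.curve 2)
    [NeZero (r.curve.conductorNorm ℤ)] (D : ModularParametrizationData r.curve (r.curve.conductorNorm ℤ))
    (hmin : ∀ D' : ModularParametrizationData r.curve (r.curve.conductorNorm ℤ), D.modularDegree ≤ D'.modularDegree) :
    Even D.modularDegree := by
  obtain ⟨hE, -, -, -, -, hsel⟩ := Rank3Row.door_two_of_mem_fullTwoTorsionRows hr
  haveI := hE
  exact ModularDegreeParity.even_of_p_parity_of_odd_selmerCorank hCE r.curve hpar (by rw [hsel]; decide) D hmin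

/-- The two routes AGREE in their intermediate: for the 966 rows the kernel gives `w(E) = −1` from `hKD`/`hR`
(root-number census) AND `(−1)^{corank Sel_{2^∞}} = (−1)^3 = −1` hypothesis-free — i.e. the 2-parity identity
`p_parity E 2` HOLDS for these rows granting only `hKD`/`hR` (the cell's 2-parity cross-check, here read back by name from
`Rank3Row.door_two_of_aKey_mem` and `Rank3Row.rootNumber_eq_neg_one_of_mem`; the table membership `hr` is needed for the
root-number census). [cite: DokchitserDokchitserAnnals2010, Thm. 1.4] [cite: KellockDokchitser2023, Thm. 2.3 and §5] -/
theorem Rank3Row.p_parity_two_of_aKey_mem_of_mem (r : Rank3Row) (hr : r ∈ rank3Table)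
    (h : aKey₃ r ∈ rank3IsoRows.map IsoRow.aKey)
    (hKD : r.curve.rootNumber_eq_neg_finprod_tableLocalRootNumberAt')
    (hR : r.curve.rootNumber_eq_neg_finprod_fullTableLocalRootNumberAt) :
    ∃ _h : r.curve.IsElliptic, p_parity r.curve 2 := by
  obtain ⟨hE, -, -, -, -, hsel⟩ := Rank3Row.door_two_of_aKey_mem h
  haveI := hE
  refine ⟨hE, ?_⟩
  show (-1 : ℤ) ^ r.curve.selmerCorank 2 = r.curve.rootNumber
  rw [hsel, Rank3Row.rootNumber_eq_neg_one_of_mem hr hKD hR]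
  norm_num

/-! ### §4 Summary -/

/-- **THE MODULAR-DEGREE PARITY OF THE RANK-3 CENSUS, granting Calegari–Emerton.**  (1) every one of the 9 487 rows has
even modular degree granting the local-root-number facts `hKD`, `hR`; (2) every one of the 966 one-2-torsion rows and
(3) every one of the 20 full-2-torsion rows has even modular degree granting instead the 2-parity theorem `hpar`; (4) the
three row lists have certified lengths 9 487 / 966 / 20.  Watkins' conjecture predicts `2³ ∣ m_E` for all of them (and
Cremona's `alldegphi` engine data confirm `2³ ∣ deg φ` on all 9 487 rows, OUT of the kernel); the kernel holds the first bit.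
HONEST FRAMING: per-curve certified theorems and census instruments; no claim on BSD in rank ≥ 2.
[cite: Watkins2002, Conjecture 4.1 (p. 498)] [cite: CalegariEmerton2008, Theorem 1 (arXiv:math/0503359, p. 2)]
[cite: Dummigan2008, Conj. 1.1 (p. 346)] [cite: CremonaAlgorithms1997, Tables] -/
theorem rank3_modularDegreeParity (hCE : calegariEmerton_oddModularDegree) :
    (∀ r ∈ rank3Table, r.curve.rootNumber_eq_neg_finprod_tableLocalRootNumberAt' →
      r.curve.rootNumber_eq_neg_finprod_fullTableLocalRootNumberAt →
      ∀ [NeZero (r.curve.conductorNorm ℤ)] (D : ModularParametrizationData r.curve (r.curve.conductorNorm ℤ)),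
        (∀ D' : ModularParametrizationData r.curve (r.curve.conductorNorm ℤ), D.modularDegree ≤ D'.modularDegree) →
        Even D.modularDegree) ∧
    (∀ r : Rank3Row, aKey₃ r ∈ rank3IsoRows.map IsoRow.aKey → p_parity r.curve 2 →
      ∀ [NeZero (r.curve.conductorNorm ℤ)] (D : ModularParametrizationData r.curve (r.curve.conductorNorm ℤ)),
        (∀ D' : ModularParametrizationData r.curve (r.curve.conductorNorm ℤ), D.modularDegree ≤ D'.modularDegree) →
        Even D.modularDegree) ∧
    (∀ r ∈ rank3FullTwoTorsionRows, p_parity r.curve 2 →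
      ∀ [NeZero (r.curve.conductorNorm ℤ)] (D : ModularParametrizationData r.curve (r.curve.conductorNorm ℤ)),
        (∀ D' : ModularParametrizationData r.curve (r.curve.conductorNorm ℤ), D.modularDegree ≤ D'.modularDegree) →
        Even D.modularDegree) ∧
    rank3Table.length = 9487 ∧ rank3IsoRows.length = 966 ∧ rank3FullTwoTorsionRows.length = 20 :=
  ⟨fun _ hr hKD hR _ D hmin => Rank3Row.even_modularDegree_of_mem hCE hr hKD hR D hmin,
   fun _ h hpar _ D hmin => Rank3Row.even_modularDegree_of_aKey_mem_of_p_parity hCE h hpar D hmin,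
   fun _ hr hpar _ D hmin => Rank3Row.even_modularDegree_of_mem_fullTwoTorsionRows_of_p_parity hCE hr hpar D hmin,
   rank3Table_length, rank3IsoRows_length, rank3FullTwoTorsionRows_length⟩


end Summit.BirchSwinnertonDyer.BirchSwinnertonDyer.Rank2Observatory
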